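import Mathlib
import Summits.NavierStokesRegularity.NavierStokesRegularity.Theorems.TaoLadderRungTwoBreakBlowupRigidityOneOutflowCore
import Summits.NavierStokesRegularity.NavierStokesRegularity.Theorems.TaoLadderRungTwoBreakBlowupRigidityOneEternalAbsorbing
import Literature.Analysis.FluidPDE.Tao2016AveragedNS.SelfSimilarCascadeBlowup
import HarnessLib

/-!
# The OUTFLOW-LIVE CORE normal form, II: a non-trivial admissible eternal solution or a non-trivial admissible DSS wave
  forces a self-sustaining core that EMITS INTO ITSELF — PEELABLE tables (conditions (P) + (E) of
  `…OutflowCore`) carry neither object at any `ε₀`, so the classification stub of K2(1)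
  `TaoLadderRungTwoBreak.BlowupRigidityOne` (stmt-NavierStokesRegularity-20206) is vacuous there and its conclusion
  unattainable (`--supports`; census item (RP′))

MODEL lattice ODEs only (Tao 2016 §4 (4.1)–(4.3), Lemma 4.1 (iii) (4.8) in self-similar variables, §6.4); nothing here
is a statement about the Navier–Stokes equations; NO item is closed.  DEF-FREE; ROUTE-INDEPENDENT.

With (P) «every driver of a mode `i ∉ C` has an input `∉ C` of rank `< rank i`» and (E) «no outflow monomial inside
`C`» (the second horn of `outflowCore_or_peelable`), for a cancelling table and ANY `ε₀`:
* `eternal_dark_of_peelable` — every shell of an admissible eternal solution is supported in `C` (induction on the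
  relative rank: once the lower-rank modes outside `C` vanish, a mode outside `C` is undriven, and an undriven
  renormalised mode vanishes by the action clause, `eternal_apply_eq_zero_of_undriven`);
* `norm_sq_eternal_of_peelable`, `eternal_trivial_of_peelable` — then no shell emits (`outflow_eq_zero_of_peelable`),
  feed and back-reaction do no work (`table_sTable`), `‖W_n(σ)‖² = ‖W_n(0)‖² e^{−2σ}`, and the action clause forces
  `W ≡ 0`; `not_eternalSurvivingFwd_of_peelable`;
* `dssWave_trivial_of_peelable` — an admissible DSS wave embeds as an admissible eternal solution
  (`IsDSSWave.isEternal_dssEmbed`), hence is trivial;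
* NUMBERS FOR THE CENSUS: `outflowCore_of_eternal_nontrivial`, `outflowCore_of_eternalSurviving`,
  `outflowCore_of_dssWave_nontrivial` (sharpening `core_of_eternalSurviving` / `core_of_dssWave_nontrivial` of
  `…Core`), and `stubEternalIsDSS_on_peelable`.
This strictly contains `eternal_trivial_of_nilpotent` (`C = ∅`), the outflow-free case (`C = univ`) and
`eternal_trivial_of_absorbing` (there the modes outside the dead set are undriven, i.e. (P) with all ranks equal).

HONEST LABEL: bookkeeping normal form for the planner; no stub, crux, rung or summit is proved; rung 0.
-/

noncomputable section

-- the summit and its single sub-problem share the name (CONVENTIONS §1)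
set_option linter.dupNamespace false

open Set Filter Topology MeasureTheory
open scoped RealInnerProductSpace

namespace Summit.NavierStokesRegularity.NavierStokesRegularity.Theorems

namespace BlowupRigidityOne

open Literature.Analysis.FluidPDE Literature.Analysis.FluidPDE.TaoCascade
  Literature.Analysis.FluidPDE.Tao2016AveragedNS

variable {m : ℕ} {R ε₀ : ℝ} {α : Fin m → Fin m → Fin m → ℤ × ℤ × ℤ → ℝ}

/-! ## Peelable tables carry no admissible eternal solution and no admissible DSS wave -/

/-- A driving form vanishes at an output `i ∉ C` when every non-zero coefficient has an input outside `C` of rank below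
`rank i` and all such modes vanish in both input vectors.
[cite: Tao2016AveragedNS, §4 (4.1); cell vocabulary (`qform`, relative nilpotent ranking)] -/
theorem qform_eq_zero_of_peel {C : Finset (Fin m)} {rank : Fin m → ℕ} {μ : ℤ × ℤ × ℤ} {i : Fin m}
    (hnil : ∀ j k, α j k i μ ≠ 0 → (j ∉ C ∧ rank j < rank i) ∨ (k ∉ C ∧ rank k < rank i)) (y x : Em m)
    (hy : ∀ j, j ∉ C → rank j < rank i → y j = 0) (hx : ∀ j, j ∉ C → rank j < rank i → x j = 0) :
    qform α μ y x i = 0 := by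
  unfold qform
  refine Finset.sum_eq_zero fun j _ => Finset.sum_eq_zero fun k _ => ?_
  by_cases h : α j k i μ = 0
  · rw [h, zero_mul]
  · rcases hnil j k h with ⟨hj, hlt⟩ | ⟨hk, hlt⟩
    · rw [hy j hj hlt, zero_mul, mul_zero]
    · rw [hx k hk hlt, mul_zero, mul_zero]

/-- **The dark modes of an admissible eternal solution of a peelable table.**  Under (P) every mode outside `C` vanishes
in every shell at every log-time (induction on the rank: once the lower-rank outside modes vanish, mode `i ∉ C` is
undriven, `eternal_apply_eq_zero_of_undriven`).
[cite: Tao2016AveragedNS, §4 (4.1), Lemma 4.1 (iii) (4.8) in self-similar variables (§6.4); cell vocabulary (`IsEternal`, clause `action`)] -/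
theorem eternal_dark_of_peelable {C : Finset (Fin m)} {rank : Fin m → ℕ}
    (hpeel : ∀ μ ∈ shiftSet, ∀ j k i, i ∉ C → α j k i μ ≠ 0 →
      (j ∉ C ∧ rank j < rank i) ∨ (k ∉ C ∧ rank k < rank i))
    {W : ℤ → ℝ → Em m} (hW : IsEternal ε₀ α W) : ∀ n σ i, i ∉ C → W n σ i = 0 := by
  have h001 : ((0 : ℤ), (0 : ℤ), (1 : ℤ)) ∈ shiftSet := by simp [shiftSet]
  have h000 : ((0 : ℤ), (0 : ℤ), (0 : ℤ)) ∈ shiftSet := by simp [shiftSet]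
  have h100 : ((1 : ℤ), (0 : ℤ), (0 : ℤ)) ∈ shiftSet := by simp [shiftSet]
  have h010 : ((0 : ℤ), (1 : ℤ), (0 : ℤ)) ∈ shiftSet := by simp [shiftSet]
  suffices hmain : ∀ r : ℕ, ∀ i : Fin m, i ∉ C → rank i < r → ∀ n σ, W n σ i = 0 by
    intro n σ i hi; exact hmain (rank i + 1) i hi (Nat.lt_succ_self _) n σ
  intro r
  induction r with
  | zero => intro i _ hi; exact absurd hi (Nat.not_lt_zero _)
  | succ r ih =>
    intro i hiC hi n
    have hlow : ∀ n' σ j, j ∉ C → rank j < rank i → W n' σ j = 0 :=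
      fun n' σ j hj hlt => ih j hj (by omega) n' σ
    refine eternal_apply_eq_zero_of_undriven hW n i fun σ => ?_
    rw [tableQ_apply, tableA_apply, tableB_apply,
      qform_eq_zero_of_peel (fun j k h => hpeel _ h000 j k i hiC h) _ _ (hlow n σ) (hlow n σ),
      qform_eq_zero_of_peel (fun j k h => hpeel _ h001 j k i hiC h) _ _ (hlow _ σ) (hlow _ σ),
      qform_eq_zero_of_peel (fun j k h => hpeel _ h100 j k i hiC h) _ _ (hlow _ σ) (hlow n σ),
      qform_eq_zero_of_peel (fun j k h => hpeel _ h010 j k i hiC h) _ _ (hlow n σ) (hlow _ σ)]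
    ring

/-- **Energy identity on a peelable table.**  Under (P) + (E) every shell of an admissible eternal solution of a
cancelling table is `C`-supported (`eternal_dark_of_peelable`) and does not emit (`outflow_eq_zero_of_peelable`), so feed
and back-reaction do no work and `‖W_n(σ)‖² = ‖W_n(0)‖² e^{−2σ}` (intra-shell neutrality and
`⟪x, B(y,x)⟫ = −⟪y, A x⟫`, `table_sTable`).
[cite: Tao2016AveragedNS, §4 (4.3), Lemma 4.1 (iii) (4.8) in self-similar variables; cell vocabulary (`IsEternal`)] -/
theorem norm_sq_eternal_of_peelable (hc : IsCancellingCoeff α) {C : Finset (Fin m)} {rank : Fin m → ℕ}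
    (hpeel : ∀ μ ∈ shiftSet, ∀ j k i, i ∉ C → α j k i μ ≠ 0 →
      (j ∉ C ∧ rank j < rank i) ∨ (k ∉ C ∧ rank k < rank i))
    (hemit : ∀ i ∈ C, ∀ j ∈ C, ∀ k ∈ C, α j k i ((0 : ℤ), (0 : ℤ), (1 : ℤ)) = 0)
    {W : ℤ → ℝ → Em m} (hW : IsEternal ε₀ α W) (n : ℤ) (σ : ℝ) :
    ‖W n σ‖ ^ 2 = ‖W n 0‖ ^ 2 * Real.exp (-(2 * σ)) := by
  have hST := table_sTable α hc
  have hdark := eternal_dark_of_peelable hpeel hW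
  have hL2 := outflow_eq_zero_of_peelable hpeel hemit
  have hAW : ∀ k z, tableA α (W k z) = 0 := fun k z =>
    tableA_eq_zero_of_supported hL2 fun i hi => hdark k z i hi
  have hder : ∀ z, HasDerivAt (fun z => ‖W n z‖ ^ 2) (-(2 * ‖W n z‖ ^ 2)) z := by
    intro z
    have h := (hW.law n z).norm_sq
    have hin : ⟪W n z, -((1 : ℝ) • W n z) + tableQ α (W n z)
        + bigLam ε₀ • tableA α (W (n - 1) z)
        + (bigLam ε₀)⁻¹ • tableB α (W (n + 1) z) (W n z)⟫ = -‖W n z‖ ^ 2 := by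
      rw [inner_add_right, inner_add_right, inner_add_right, inner_neg_right, inner_smul_right,
        inner_smul_right, inner_smul_right, real_inner_self_eq_norm_sq, hST.intra, hAW (n - 1) z, inner_zero_right]
      have hB : ⟪W n z, tableB α (W (n + 1) z) (W n z)⟫ = 0 := by
        have h2 := hST.cancel (W n z) (W (n + 1) z)
        rw [hAW n z, inner_zero_right, zero_add] at h2
        exact h2
      rw [hB]
      ring
    rw [hin] at h
    convert h using 1
    ring
  have hconst : ∀ z, Real.exp (2 * z) * ‖W n z‖ ^ 2 = ‖W n 0‖ ^ 2 := by
    intro z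
    have hd : ∀ w, HasDerivAt (fun w => Real.exp (2 * w) * ‖W n w‖ ^ 2) 0 w := by
      intro w
      have he : HasDerivAt (fun w => Real.exp (2 * w)) (Real.exp (2 * w) * 2) w := by
        have := (hasDerivAt_id w).const_mul (2 : ℝ)
        simp only [mul_one] at this
        exact (Real.hasDerivAt_exp (2 * w)).comp w this
      have h1 := he.mul (hder w)
      have e : Real.exp (2 * w) * 2 * ‖W n w‖ ^ 2 + Real.exp (2 * w) * (-(2 * ‖W n w‖ ^ 2)) = 0 := by ring
      rw [e] at h1
      exact h1
    have h := is_const_of_deriv_eq_zero (f := fun w => Real.exp (2 * w) * ‖W n w‖ ^ 2)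
      (fun w => (hd w).differentiableAt) (fun w => (hd w).deriv) z 0
    simpa using h
  have h := hconst σ
  have hexp : Real.exp (2 * σ) * Real.exp (-(2 * σ)) = 1 := by
    rw [← Real.exp_add, add_neg_cancel, Real.exp_zero]
  calc ‖W n σ‖ ^ 2 = Real.exp (2 * σ) * ‖W n σ‖ ^ 2 * Real.exp (-(2 * σ)) := by
        rw [mul_comm (Real.exp (2 * σ)), mul_assoc, hexp, mul_one]
    _ = ‖W n 0‖ ^ 2 * Real.exp (-(2 * σ)) := by rw [h]

/-- **NO NON-TRIVIAL ADMISSIBLE ETERNAL SOLUTION ON A PEELABLE TABLE** ((P) + (E), cancelling, ANY `ε₀`): each shell has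
mass `‖W_n(0)‖ e^{−σ}` (`norm_sq_eternal_of_peelable`), which the action clause excludes unless `W_n(0) = 0`.  This is
the common generalisation of `eternal_trivial_of_nilpotent` (`C = ∅`), of the outflow-free case and of
`eternal_trivial_of_absorbing`.
[cite: Tao2016AveragedNS, §4 (4.3), Lemma 4.1 (iii) (4.8); cell vocabulary (`IsEternal`, clause `action`)] -/
theorem eternal_trivial_of_peelable (hc : IsCancellingCoeff α) {C : Finset (Fin m)} {rank : Fin m → ℕ}
    (hpeel : ∀ μ ∈ shiftSet, ∀ j k i, i ∉ C → α j k i μ ≠ 0 →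
      (j ∉ C ∧ rank j < rank i) ∨ (k ∉ C ∧ rank k < rank i))
    (hemit : ∀ i ∈ C, ∀ j ∈ C, ∀ k ∈ C, α j k i ((0 : ℤ), (0 : ℤ), (1 : ℤ)) = 0)
    {W : ℤ → ℝ → Em m} (hW : IsEternal ε₀ α W) : ∀ n σ, W n σ = 0 := by
  intro n
  have h0 : ‖W n 0‖ = 0 := by
    by_contra hne
    obtain ⟨M, hM⟩ := hW.action
    have hint : Integrable (fun σ => ‖W n σ‖) := (hM n).1
    have heq : (fun σ => ‖W n σ‖) = fun σ => ‖W n 0‖ * Real.exp (-σ) := by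
      funext σ
      have hsq := norm_sq_eternal_of_peelable hc hpeel hemit hW n σ
      have hrhs : ‖W n 0‖ ^ 2 * Real.exp (-(2 * σ)) = (‖W n 0‖ * Real.exp (-σ)) ^ 2 := by
        have h2 : Real.exp (-(2 * σ)) = Real.exp (-σ) ^ 2 := by
          rw [sq, ← Real.exp_add]
          exact congrArg Real.exp (by ring)
        rw [h2, mul_pow]
      rw [hrhs] at hsq
      exact (pow_left_inj₀ (norm_nonneg _) (by positivity) two_ne_zero).1 hsq
    rw [heq] at hint
    have hexp : Integrable (fun σ : ℝ => Real.exp (-σ)) := by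
      have := hint.const_mul (‖W n 0‖⁻¹)
      refine this.congr (Eventually.of_forall fun σ => ?_)
      simp only
      rw [← mul_assoc, inv_mul_cancel₀ hne, one_mul]
    exact not_integrable_exp_neg hexp
  intro σ
  have hsq := norm_sq_eternal_of_peelable hc hpeel hemit hW n σ
  rw [h0] at hsq
  simp only [ne_eq, OfNat.ofNat_ne_zero, not_false_eq_true, zero_pow, zero_mul] at hsq
  exact norm_eq_zero.1 (pow_eq_zero_iff two_ne_zero |>.1 hsq)

/-- **No admissible eternal solution of a peelable table is (S_a)-surviving forward** (any `a`, any `ε₀`).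
[cite: Tao2016AveragedNS, §4 (4.8), §6.4; cell vocabulary (`IsEternal`, `EternalSurvivingFwd`)] -/
theorem not_eternalSurvivingFwd_of_peelable (hc : IsCancellingCoeff α) {C : Finset (Fin m)} {rank : Fin m → ℕ}
    (hpeel : ∀ μ ∈ shiftSet, ∀ j k i, i ∉ C → α j k i μ ≠ 0 →
      (j ∉ C ∧ rank j < rank i) ∨ (k ∉ C ∧ rank k < rank i))
    (hemit : ∀ i ∈ C, ∀ j ∈ C, ∀ k ∈ C, α j k i ((0 : ℤ), (0 : ℤ), (1 : ℤ)) = 0)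
    {W : ℤ → ℝ → Em m} (hW : IsEternal ε₀ α W) (a : ℝ) : ¬ EternalSurvivingFwd a ε₀ W := by
  rintro ⟨c, hc0, H⟩
  obtain ⟨n, -, σ, -, hle⟩ := H 0
  rw [eternal_trivial_of_peelable hc hpeel hemit hW n σ, norm_zero] at hle
  simp only [ne_eq, OfNat.ofNat_ne_zero, not_false_eq_true, zero_pow, mul_zero] at hle
  exact absurd hle (not_le.2 hc0)

/-- **NO NON-TRIVIAL ADMISSIBLE DSS WAVE ON A PEELABLE TABLE** ((P) + (E), cancelling, ANY `ε₀`, any delay, any finite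
profile family): the wave embeds as an admissible eternal solution (`IsDSSWave.isEternal_dssEmbed`, shell `0` carrying
the profile `r`), which is trivial by `eternal_trivial_of_peelable`.  So on peelable tables K1(1) holds outright and the
CONCLUSION of K2(1) is unattainable — consistently with its hypothesis being void there.
[cite: Tao2016AveragedNS, §4 Lemma 4.1 (iii) (4.8); cell vocabulary (`IsDSSWave`, `dssEmbed`)] -/
theorem dssWave_trivial_of_peelable (hc : IsCancellingCoeff α) {C : Finset (Fin m)} {rank : Fin m → ℕ}
    (hpeel : ∀ μ ∈ shiftSet, ∀ j k i, i ∉ C → α j k i μ ≠ 0 →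
      (j ∉ C ∧ rank j < rank i) ∨ (k ∉ C ∧ rank k < rank i))
    (hemit : ∀ i ∈ C, ∀ j ∈ C, ∀ k ∈ C, α j k i ((0 : ℤ), (0 : ℤ), (1 : ℤ)) = 0)
    {ρ : Type*} [Fintype ρ] {π : Equiv.Perm ρ} {T : ℝ} {Φ : ρ → ℝ → Em m}
    (hW : IsDSSWave ε₀ α π T Φ) : ∀ r x, Φ r x = 0 := by
  intro r x
  have h := eternal_trivial_of_peelable hc hpeel hemit (hW.isEternal_dssEmbed r) 0 x
  simpa [dssEmbed] using h

/-- **A NON-TRIVIAL ADMISSIBLE ETERNAL SOLUTION FORCES AN OUTFLOW-LIVE CORE** (cancelling table, any `ε₀`).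
[cite: Tao2016AveragedNS, §4 (4.3), (4.8), §6.4; cell vocabulary (`IsEternal`, outflow-live core)] -/
theorem outflowCore_of_eternal_nontrivial (hc : IsCancellingCoeff α) {W : ℤ → ℝ → Em m} (hW : IsEternal ε₀ α W)
    (hne : ∃ n σ, W n σ ≠ 0) :
    ∃ C : Finset (Fin m), (∀ i ∈ C, ∃ μ ∈ shiftSet, ∃ j ∈ C, ∃ k ∈ C, α j k i μ ≠ 0) ∧
      ∃ i ∈ C, ∃ j ∈ C, ∃ k ∈ C, α j k i ((0 : ℤ), (0 : ℤ), (1 : ℤ)) ≠ 0 := by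
  rcases outflowCore_or_peelable α with h | ⟨C, rank, hpeel, hemit⟩
  · exact h
  · obtain ⟨n, σ, h⟩ := hne
    exact absurd (eternal_trivial_of_peelable hc hpeel hemit hW n σ) h

/-- **A surviving admissible eternal solution forces an outflow-live core** (cancelling table, any `ε₀`, any `a`) —
sharpening `core_of_eternalSurviving`.
[cite: Tao2016AveragedNS, §4 (4.8), §6.4; cell vocabulary (`IsEternal`, `EternalSurvivingFwd`, outflow-live core)] -/
theorem outflowCore_of_eternalSurviving (hc : IsCancellingCoeff α) {W : ℤ → ℝ → Em m} {a : ℝ}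
    (hW : IsEternal ε₀ α W) (hS : EternalSurvivingFwd a ε₀ W) :
    ∃ C : Finset (Fin m), (∀ i ∈ C, ∃ μ ∈ shiftSet, ∃ j ∈ C, ∃ k ∈ C, α j k i μ ≠ 0) ∧
      ∃ i ∈ C, ∃ j ∈ C, ∃ k ∈ C, α j k i ((0 : ℤ), (0 : ℤ), (1 : ℤ)) ≠ 0 := by
  rcases outflowCore_or_peelable α with h | ⟨C, rank, hpeel, hemit⟩
  · exact h
  · exact absurd hS (not_eternalSurvivingFwd_of_peelable hc hpeel hemit hW a)

/-- **A non-trivial admissible DSS wave forces an outflow-live core** (cancelling table, any `ε₀`) — sharpening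
`core_of_dssWave_nontrivial`.
[cite: Tao2016AveragedNS, §4 Lemma 4.1 (iii) (4.8); cell vocabulary (`IsDSSWave`, outflow-live core)] -/
theorem outflowCore_of_dssWave_nontrivial (hc : IsCancellingCoeff α) {ρ : Type*} [Fintype ρ] {π : Equiv.Perm ρ}
    {T : ℝ} {Φ : ρ → ℝ → Em m} (hW : IsDSSWave ε₀ α π T Φ) (hne : ∃ r x, Φ r x ≠ 0) :
    ∃ C : Finset (Fin m), (∀ i ∈ C, ∃ μ ∈ shiftSet, ∃ j ∈ C, ∃ k ∈ C, α j k i μ ≠ 0) ∧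
      ∃ i ∈ C, ∃ j ∈ C, ∃ k ∈ C, α j k i ((0 : ℤ), (0 : ℤ), (1 : ℤ)) ≠ 0 := by
  rcases outflowCore_or_peelable α with h | ⟨C, rank, hpeel, hemit⟩
  · exact h
  · obtain ⟨r, x, h⟩ := hne
    exact absurd (dssWave_trivial_of_peelable hc hpeel hemit hW r x) h

/-- **THE CLASSIFICATION STUB ON PEELABLE TABLES, EVERY `ε₀`** (vacuously: no surviving eternal solution there).
[cite: Tao2016AveragedNS, §4 (4.8), §6.4; cell vocabulary (`stub_eternalIsDSS` of skeleton 9d85f4d387c689cd)] -/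
theorem stubEternalIsDSS_on_peelable (hc : IsCancellingCoeff α) {C : Finset (Fin m)} {rank : Fin m → ℕ}
    (hpeel : ∀ μ ∈ shiftSet, ∀ j k i, i ∉ C → α j k i μ ≠ 0 →
      (j ∉ C ∧ rank j < rank i) ∨ (k ∉ C ∧ rank k < rank i))
    (hemit : ∀ i ∈ C, ∀ j ∈ C, ∀ k ∈ C, α j k i ((0 : ℤ), (0 : ℤ), (1 : ℤ)) = 0) (ε₀ : ℝ)
    (hex : ∃ W : ℤ → ℝ → Em m, IsEternal ε₀ α W ∧ EternalSurvivingFwd 1 ε₀ W) :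
    ∃ (q : ℕ) (π : Equiv.Perm (Fin q)) (T : ℝ) (Φ : Fin q → ℝ → Em m),
      IsDSSWave ε₀ α π T Φ ∧ Surviving 1 ε₀ T ∧ ∃ r x, Φ r x ≠ 0 := by
  obtain ⟨W, hW, hS⟩ := hex
  exact absurd hS (not_eternalSurvivingFwd_of_peelable hc hpeel hemit hW 1)

end BlowupRigidityOne

end Summit.NavierStokesRegularity.NavierStokesRegularity.Theorems

end
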